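import Mathlib
import HarnessLib

/-!
# Route NegLimited — door support: Impagliazzo's hard-core lemma (boosting form, any finite weight)
(rung F-N1/p3, ROUND-11 engine, ingredient [A] "monotone hardness amplification"; cell pnp-ideate)

The first step of p3's monotone hardness amplification (STATUS 2026-08-26T17:27:57Z) for the door
`NeglimitedEpsLogNegationsR` (stmt-PneNP-19860) is Impagliazzo's hard-core lemma for a predictor
class closed under majorities (majorities of monotone circuits are monotone circuits).  Proved here
in its constructive form (Impagliazzo 1995 §4) for an ARBITRARY finite domain `X`, nonnegative
weight `D` and predictor set `𝒢` — no circuits, no complexity measure: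
* `hardCore_boosting` — if every measure `M : X → [0,1]` of `D`-mass `≥ δ·D(X)` admits `g ∈ 𝒢`
  with advantage `Σ_x D x · M x · (±1)_{g x = f x} ≥ ε · Σ_x D x · M x`, then `t ≤ 4/(εδ)² + 2/(εδ)`
  predictors `g_0, …, g_{t−1} ∈ 𝒢` have signed vote `Σ_i (±1)_{g_i x = f x} ≤ 0` only on a set of
  `D`-mass `< δ·D(X)` (the strict majority vote computes `f` off that set);
* `hardCore_measure` — contrapositive: `δ`-hardness of `f` under `D` for all such majorities gives
  a HARD-CORE MEASURE `M` (`0 ≤ M ≤ 1`, `D`-mass `≥ δ·D(X)`) on which every `g ∈ 𝒢` has advantage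
  `< ε · Σ D M`, i.e. `Pr_{D_M}[g = f] < 1/2 + ε/2`.
Proof: Impagliazzo's iteration with clamped linear weights `M_j = clamp(1 − σ N_j)`, `σ = εδ/2`;
the per-point elevator bound `Σ_{j<i} r_j M_j(x) ≤ 1/σ + 1 + σ i` (`elevator_sum_le`, discrete
potential `psi`) against the per-round gain `εδ·D(X)` bounds the number of rounds (`rounds_le`).
Constants not optimised (Impagliazzo: `2/(εδ)²`).  References: R. Impagliazzo, *Hard-core
distributions for somewhat hard problems*, FOCS 1995, §4 Lemma 1 [Impagliazzo1995]; A. Klivans,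
R. Servedio, *Boosting and hard-core sets*, FOCS 1999, §2.2 Thm 5 [KlivansServedio2003].
HONEST FRAMING: a generic combinatorial lemma; no circuit lower bound; nothing on P vs NP.
-/


set_option linter.dupNamespace false -- `Summit.PneNP.PneNP.…`: summit = sub-problem name (D-0017 single-conjunct layout)

namespace Summit.PneNP.PneNP.Theorems.NegLimitedDoor.HardCore

open Finset

/-! ### Clamped linear weights and the correctness sign -/

/-- The clamped linear weight `clampW σ N = max 0 (min 1 (1 − σ N))`. -/
noncomputable def clampW (σ N : ℝ) : ℝ := max 0 (min 1 (1 - σ * N))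

/-- `0 ≤ clampW σ N`. -/
theorem clampW_nonneg (σ N : ℝ) : 0 ≤ clampW σ N := le_max_left _ _

/-- `clampW σ N ≤ 1`. -/
theorem clampW_le_one (σ N : ℝ) : clampW σ N ≤ 1 := max_le zero_le_one (min_le_left _ _)

/-- For `σ ≥ 0` and `N ≤ 0` the weight is `1`. -/
theorem clampW_of_nonpos {σ N : ℝ} (hσ : 0 ≤ σ) (hN : N ≤ 0) : clampW σ N = 1 := by
  unfold clampW
  have h : 1 ≤ 1 - σ * N := by nlinarith
  rw [min_eq_left h]
  exact max_eq_right zero_le_one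

/-- For `σ N ≥ 1` the weight is `0`. -/
theorem clampW_of_one_le {σ N : ℝ} (h : 1 ≤ σ * N) : clampW σ N = 0 := by
  unfold clampW
  exact max_eq_left ((min_le_right _ _).trans (by linarith))

/-- The clamp `u ↦ max 0 (min 1 u)` is `1`-Lipschitz from above: `u ≤ v + σ ⇒ clamp u ≤ clamp v + σ`. -/
theorem clamp01_le_add {u v σ : ℝ} (hσ : 0 ≤ σ) (h : u ≤ v + σ) :
    max 0 (min 1 u) ≤ max 0 (min 1 v) + σ := by
  have hmin : min 1 u ≤ min 1 v + σ := by
    rcases le_total 1 v with hv | hv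
    · rw [min_eq_left hv]
      exact (min_le_left _ _).trans (by linarith)
    · rw [min_eq_right hv]
      exact (min_le_right _ _).trans h
  rcases le_total 0 (min 1 v) with h0 | h0
  · rw [max_eq_right h0]
    exact max_le (by linarith) hmin
  · rw [max_eq_left h0]
    exact max_le (by linarith) (by linarith)

/-- One down-step costs at most `σ`: `clampW σ (N − 1) − clampW σ N ≤ σ` (for `σ ≥ 0`). -/
theorem clampW_sub_le {σ : ℝ} (hσ : 0 ≤ σ) (N : ℝ) : clampW σ (N - 1) - clampW σ N ≤ σ := by
  have h : 1 - σ * (N - 1) ≤ (1 - σ * N) + σ := by linarith [mul_sub σ N 1]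
  have := clamp01_le_add hσ h
  unfold clampW
  linarith

/-- The correctness sign of a predictor `g` against `f` at `x`: `+1` if `g x = f x`, else `−1`. -/
def rsign {X : Type*} (f g : X → Bool) (x : X) : ℤ := if g x = f x then 1 else -1

/-- `rsign` is `±1`. -/
theorem rsign_eq_or {X : Type*} (f g : X → Bool) (x : X) : rsign f g x = 1 ∨ rsign f g x = -1 := by
  unfold rsign
  split_ifs <;> simp

/-- The real cast of `rsign` is the `±1` indicator. -/
theorem rsign_cast {X : Type*} (f g : X → Bool) (x : X) :
    ((rsign f g x : ℤ) : ℝ) = if g x = f x then (1 : ℝ) else -1 := by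
  unfold rsign
  split_ifs <;> simp

/-! ### The discrete potential and the elevator bound -/

/-- The discrete potential `psi σ N = Σ_{0 ≤ k < N} clampW σ k` for `N ≥ 0` and `psi σ N = N` for
`N ≤ 0` (the weights are `1` at negative levels), so that `psi σ (N+1) − psi σ N = clampW σ N`. -/
noncomputable def psi (σ : ℝ) (N : ℤ) : ℝ :=
  (∑ k ∈ range N.toNat, clampW σ k) - ((-N).toNat : ℝ)

/-- `psi σ 0 = 0`. -/
theorem psi_zero (σ : ℝ) : psi σ 0 = 0 := by
  simp [psi]

/-- The discrete derivative of the potential is the weight: `psi σ (N+1) − psi σ N = clampW σ N`. -/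
theorem psi_succ_sub {σ : ℝ} (hσ : 0 ≤ σ) (N : ℤ) : psi σ (N + 1) - psi σ N = clampW σ N := by
  rcases le_or_gt 0 N with hN | hN
  · have h1 : (N + 1).toNat = N.toNat + 1 := by omega
    have h2 : (-(N + 1)).toNat = 0 := by omega
    have h3 : (-N).toNat = 0 := by omega
    have h4 : ((N.toNat : ℕ) : ℝ) = ((N : ℤ) : ℝ) := by
      have h := Int.toNat_of_nonneg hN
      exact_mod_cast h
    unfold psi
    rw [h1, h2, h3, sum_range_succ, h4]
    push_cast
    ring
  · have h1 : (N + 1).toNat = 0 := by omega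
    have h0 : N.toNat = 0 := by omega
    have h2 : (((-(N + 1)).toNat : ℕ) : ℝ) = (((-(N + 1)) : ℤ) : ℝ) := by
      have h := Int.toNat_of_nonneg (show 0 ≤ -(N + 1) by omega)
      exact_mod_cast h
    have h3 : (((-N).toNat : ℕ) : ℝ) = (((-N) : ℤ) : ℝ) := by
      have h := Int.toNat_of_nonneg (show 0 ≤ -N by omega)
      exact_mod_cast h
    have hc : clampW σ N = 1 := clampW_of_nonpos hσ (by exact_mod_cast hN.le)
    unfold psi
    rw [h1, h0, sum_range_zero, h2, h3, hc]
    push_cast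
    ring

/-- The potential is bounded: `psi σ N ≤ 1/σ + 1` (the weights vanish above level `1/σ`). -/
theorem psi_le {σ : ℝ} (hσ : 0 < σ) (N : ℤ) : psi σ N ≤ 1 / σ + 1 := by
  set K : ℕ := ⌊1 / σ⌋₊ + 1 with hK
  have hKgt : 1 / σ < (K : ℝ) := by
    rw [hK]
    push_cast
    exact Nat.lt_floor_add_one _
  have hKle : (K : ℝ) ≤ 1 / σ + 1 := by
    rw [hK]
    push_cast
    linarith [Nat.floor_le (show (0 : ℝ) ≤ 1 / σ by positivity)]
  have hterm : ∀ k : ℕ, clampW σ k ≤ if k < K then (1 : ℝ) else 0 := by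
    intro k
    split_ifs with hk
    · exact clampW_le_one _ _
    · have hk' : (K : ℝ) ≤ k := by exact_mod_cast not_lt.mp hk
      have h1 : 1 ≤ σ * k := by
        have : 1 / σ < k := hKgt.trans_le hk'
        rw [div_lt_iff₀ hσ] at this
        linarith
      rw [clampW_of_one_le h1]
  have hsum : ∑ k ∈ range N.toNat, clampW σ k ≤ K := by
    calc ∑ k ∈ range N.toNat, clampW σ k
        ≤ ∑ k ∈ range N.toNat, (if k < K then (1 : ℝ) else 0) := sum_le_sum fun k _ => hterm k
      _ = #((range N.toNat).filter fun k => k < K) := by rw [sum_boole]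
      _ ≤ #(range K) := by
          gcongr
          intro k hk
          simp only [mem_filter, mem_range] at hk ⊢
          exact hk.2
      _ = K := by simp
  have hnn : (0 : ℝ) ≤ ((-N).toNat : ℝ) := Nat.cast_nonneg _
  unfold psi
  linarith

/-- **The elevator bound.**  For a `±1` step sequence `r` with partial sums `N` (`N 0 = 0`,
`N (j+1) = N j + r j`) and `σ > 0`: `Σ_{j<i} r_j · clampW σ (N_j) ≤ 1/σ + 1 + σ i` (telescoping the
potential `psi`; up-steps are exact, down-steps cost at most `σ` each). -/
theorem elevator_sum_le {σ : ℝ} (hσ : 0 < σ) (N r : ℕ → ℤ) (hN0 : N 0 = 0)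
    (hstep : ∀ j, N (j + 1) = N j + r j) (hr : ∀ j, r j = 1 ∨ r j = -1) (i : ℕ) :
    ∑ j ∈ range i, (r j : ℝ) * clampW σ (N j) ≤ 1 / σ + 1 + σ * i := by
  have hstepψ : ∀ j, (r j : ℝ) * clampW σ (N j) ≤ psi σ (N (j + 1)) - psi σ (N j) + σ := by
    intro j
    rcases hr j with h | h
    · rw [hstep j, h]
      have e := psi_succ_sub hσ.le (N j)
      push_cast
      linarith
    · rw [hstep j, h]
      have e := psi_succ_sub hσ.le (N j + -1)
      rw [neg_add_cancel_right] at e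
      have hl := clampW_sub_le hσ.le ((N j : ℤ) : ℝ)
      have e2 : (((N j + -1 : ℤ)) : ℝ) = ((N j : ℤ) : ℝ) - 1 := by push_cast; ring
      rw [e2] at e
      push_cast
      linarith
  calc ∑ j ∈ range i, (r j : ℝ) * clampW σ (N j)
      ≤ ∑ j ∈ range i, (psi σ (N (j + 1)) - psi σ (N j) + σ) := sum_le_sum fun j _ => hstepψ j
    _ = psi σ (N i) - psi σ (N 0) + σ * i := by
        rw [sum_add_distrib, sum_range_sub (fun j => psi σ (N j)), sum_const, card_range,
          nsmul_eq_mul]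
        ring
    _ ≤ 1 / σ + 1 + σ * i := by
        rw [hN0, psi_zero]
        linarith [psi_le hσ (N i)]

/-! ### Impagliazzo's iteration -/

section Boosting

variable {X : Type*} [Fintype X]

/-- The signed margin `N_j(x)` after `j` rounds of Impagliazzo's iteration driven by the predictor
oracle `pick` (round `j` uses the predictor `pick (clampW σ ∘ N_j)`). -/
noncomputable def margin (f : X → Bool) (pick : (X → ℝ) → (X → Bool)) (σ : ℝ) : ℕ → X → ℤ
  | 0 => fun _ => 0
  | j + 1 => fun x => margin f pick σ j x +
      rsign f (pick fun y => clampW σ (margin f pick σ j y)) x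

/-- The `j`-th measure `M_j = clampW σ ∘ N_j`. -/
noncomputable def meas (f : X → Bool) (pick : (X → ℝ) → (X → Bool)) (σ : ℝ) (j : ℕ) : X → ℝ :=
  fun x => clampW σ (margin f pick σ j x)

/-- The `j`-th predictor `g_j = pick M_j`. -/
noncomputable def hyp (f : X → Bool) (pick : (X → ℝ) → (X → Bool)) (σ : ℝ) (j : ℕ) : X → Bool :=
  pick (meas f pick σ j)

omit [Fintype X] in
/-- The margin recursion: `N_{j+1}(x) = N_j(x) + rsign f g_j x`. -/
theorem margin_succ (f : X → Bool) (pick : (X → ℝ) → (X → Bool)) (σ : ℝ) (j : ℕ) (x : X) :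
    margin f pick σ (j + 1) x = margin f pick σ j x + rsign f (hyp f pick σ j) x := rfl

omit [Fintype X] in
/-- The margin is the signed vote of the first `j` predictors. -/
theorem margin_eq_sum (f : X → Bool) (pick : (X → ℝ) → (X → Bool)) (σ : ℝ) (j : ℕ) (x : X) :
    margin f pick σ j x = ∑ i ∈ range j, rsign f (hyp f pick σ i) x := by
  induction j with
  | zero => simp [margin]
  | succ j ih => rw [margin_succ, ih, sum_range_succ]

omit [Fintype X] in
/-- The measures take values in `[0, 1]`. -/
theorem meas_mem (f : X → Bool) (pick : (X → ℝ) → (X → Bool)) (σ : ℝ) (j : ℕ) (x : X) :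
    0 ≤ meas f pick σ j x ∧ meas f pick σ j x ≤ 1 :=
  ⟨clampW_nonneg _ _, clampW_le_one _ _⟩

/-- **Round bound.**  If the first `i` measures all have `D`-mass `≥ δ·D(X)` and each round's
predictor has advantage `≥ ε` on its measure, then `i ≤ 4/(εδ)² + 2/(εδ)` (slope `σ = εδ/2`). -/
theorem rounds_le (D : X → ℝ) (hD : ∀ x, 0 ≤ D x) (hW : 0 < ∑ x, D x) (f : X → Bool)
    (pick : (X → ℝ) → (X → Bool)) {ε δ σ : ℝ} (hε : 0 < ε) (hδ : 0 < δ) (hσ : σ = ε * δ / 2)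
    (i : ℕ) (hdens : ∀ j < i, δ * ∑ x, D x ≤ ∑ x, D x * meas f pick σ j x)
    (hadv : ∀ j < i, ε * ∑ x, D x * meas f pick σ j x ≤
      ∑ x, D x * meas f pick σ j x * (if hyp f pick σ j x = f x then (1 : ℝ) else -1)) :
    (i : ℝ) ≤ 4 / (ε * δ) ^ 2 + 2 / (ε * δ) := by
  have hεδ : 0 < ε * δ := mul_pos hε hδ
  have hσpos : 0 < σ := by rw [hσ]; positivity
  set W := ∑ x, D x with hWdef
  -- lower bound: each round gains `ε δ W`
  have hlow : (i : ℝ) * (ε * δ * W) ≤ ∑ j ∈ range i,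
      ∑ x, D x * meas f pick σ j x * (if hyp f pick σ j x = f x then (1 : ℝ) else -1) := by
    have hj : ∀ j ∈ range i, ε * δ * W ≤
        ∑ x, D x * meas f pick σ j x * (if hyp f pick σ j x = f x then (1 : ℝ) else -1) := by
      intro j hj
      have hj' := mem_range.1 hj
      calc ε * δ * W = ε * (δ * W) := by ring
        _ ≤ ε * ∑ x, D x * meas f pick σ j x := mul_le_mul_of_nonneg_left (hdens j hj') hε.le
        _ ≤ _ := hadv j hj'
    calc (i : ℝ) * (ε * δ * W) = ∑ j ∈ range i, ε * δ * W := by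
          rw [sum_const, card_range, nsmul_eq_mul]
      _ ≤ _ := sum_le_sum hj
  -- rewrite the double sum pointwise and apply the elevator bound
  have hswap : ∑ j ∈ range i,
      ∑ x, D x * meas f pick σ j x * (if hyp f pick σ j x = f x then (1 : ℝ) else -1) =
      ∑ x, D x * ∑ j ∈ range i, ((rsign f (hyp f pick σ j) x : ℤ) : ℝ) * meas f pick σ j x := by
    rw [sum_comm]
    refine sum_congr rfl fun x _ => ?_
    rw [mul_sum]
    refine sum_congr rfl fun j _ => ?_
    rw [rsign_cast]
    ring
  have helev : ∀ x, ∑ j ∈ range i, ((rsign f (hyp f pick σ j) x : ℤ) : ℝ) * meas f pick σ j x ≤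
      1 / σ + 1 + σ * i := fun x =>
    elevator_sum_le hσpos (fun j => margin f pick σ j x) (fun j => rsign f (hyp f pick σ j) x) rfl
      (fun j => rfl) (fun j => rsign_eq_or f _ x) i
  have key : (i : ℝ) * (ε * δ * W) ≤ W * (1 / σ + 1 + σ * i) := by
    calc (i : ℝ) * (ε * δ * W) ≤ _ := hlow
      _ = _ := hswap
      _ ≤ ∑ x, D x * (1 / σ + 1 + σ * i) :=
          sum_le_sum fun x _ => mul_le_mul_of_nonneg_left (helev x) (hD x)
      _ = W * (1 / σ + 1 + σ * i) := by rw [← sum_mul]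
  have key' : (i : ℝ) * (ε * δ) ≤ 1 / σ + 1 + σ * i := by
    have h2 : ((i : ℝ) * (ε * δ)) * W ≤ (1 / σ + 1 + σ * i) * W := by
      calc ((i : ℝ) * (ε * δ)) * W = (i : ℝ) * (ε * δ * W) := by ring
        _ ≤ W * (1 / σ + 1 + σ * i) := key
        _ = (1 / σ + 1 + σ * i) * W := by ring
    exact le_of_mul_le_mul_right h2 hW
  rw [hσ, one_div_div] at key'
  have h1 : (i : ℝ) * (ε * δ / 2) ≤ 2 / (ε * δ) + 1 := by linarith
  have h2 : (i : ℝ) ≤ (2 / (ε * δ) + 1) / (ε * δ / 2) := by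
    rw [le_div_iff₀ (by positivity)]
    exact h1
  calc (i : ℝ) ≤ (2 / (ε * δ) + 1) / (ε * δ / 2) := h2
    _ = 4 / (ε * δ) ^ 2 + 2 / (ε * δ) := by
        field_simp
        ring

/-- **Impagliazzo's hard-core lemma, boosting form** (any finite domain, any nonnegative weight `D`,
any predictor set `𝒢`).  If every measure `M : X → [0,1]` of `D`-mass `≥ δ·D(X)` admits a predictor
`g ∈ 𝒢` with correlation advantage `≥ ε` (`Σ D·M·(±1)_{g=f} ≥ ε Σ D·M`), then some `t ≤ 4/(εδ)² + 2/(εδ)`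
predictors `g_0, …, g_{t−1} ∈ 𝒢` have signed vote `Σ_i (±1)_{g_i x = f x} ≤ 0` only on a set of
`D`-mass `< δ·D(X)`: the strict majority vote computes `f` off a set of mass `< δ`.
[cite: Impagliazzo1995, §4 Lemma 1] -/
theorem hardCore_boosting (D : X → ℝ) (hD : ∀ x, 0 ≤ D x) (hW : 0 < ∑ x, D x) (f : X → Bool)
    (𝒢 : Set (X → Bool)) {ε δ : ℝ} (hε : 0 < ε) (hδ : 0 < δ)
    (hweak : ∀ M : X → ℝ, (∀ x, 0 ≤ M x) → (∀ x, M x ≤ 1) → δ * ∑ x, D x ≤ ∑ x, D x * M x →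
      ∃ g ∈ 𝒢, ε * ∑ x, D x * M x ≤ ∑ x, D x * M x * (if g x = f x then (1 : ℝ) else -1)) :
    ∃ (t : ℕ) (gs : Fin t → (X → Bool)), (t : ℝ) ≤ 4 / (ε * δ) ^ 2 + 2 / (ε * δ) ∧
      (∀ i, gs i ∈ 𝒢) ∧
      ∑ x ∈ univ.filter (fun x => ∑ i, (if gs i x = f x then (1 : ℤ) else -1) ≤ 0), D x <
        δ * ∑ x, D x := by
  classical
  -- the predictor oracle
  let pick : (X → ℝ) → (X → Bool) := fun M =>
    if h : (∀ x, 0 ≤ M x) ∧ (∀ x, M x ≤ 1) ∧ δ * ∑ x, D x ≤ ∑ x, D x * M x then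
      Classical.choose (hweak M h.1 h.2.1 h.2.2) else fun _ => true
  have hpick : ∀ M : X → ℝ, (∀ x, 0 ≤ M x) → (∀ x, M x ≤ 1) → δ * ∑ x, D x ≤ ∑ x, D x * M x →
      pick M ∈ 𝒢 ∧ ε * ∑ x, D x * M x ≤ ∑ x, D x * M x * (if pick M x = f x then (1 : ℝ) else -1) := by
    intro M h0 h1 hd
    have hh : (∀ x, 0 ≤ M x) ∧ (∀ x, M x ≤ 1) ∧ δ * ∑ x, D x ≤ ∑ x, D x * M x := ⟨h0, h1, hd⟩
    have hdef : pick M = Classical.choose (hweak M h0 h1 hd) := by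
      simp only [pick, dif_pos hh]
    rw [hdef]
    exact Classical.choose_spec (hweak M h0 h1 hd)
  set σ : ℝ := ε * δ / 2 with hσ
  -- some round has small mass
  let P : ℕ → Prop := fun j => ∑ x, D x * meas f pick σ j x < δ * ∑ x, D x
  have hexP : ∃ j, P j := by
    by_contra hno
    have hall : ∀ j, δ * ∑ x, D x ≤ ∑ x, D x * meas f pick σ j x := fun j =>
      not_lt.mp fun h => hno ⟨j, h⟩
    set B : ℕ := ⌊4 / (ε * δ) ^ 2 + 2 / (ε * δ)⌋₊ + 1 with hB
    have hle := rounds_le D hD hW f pick hε hδ hσ B (fun j _ => hall j)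
      (fun j _ => (hpick _ (fun x => (meas_mem f pick σ j x).1)
        (fun x => (meas_mem f pick σ j x).2) (hall j)).2)
    have hlt : 4 / (ε * δ) ^ 2 + 2 / (ε * δ) < (B : ℝ) := by
      rw [hB]
      push_cast
      exact Nat.lt_floor_add_one _
    linarith
  -- the first such round
  let t := Nat.find hexP
  have ht : P t := Nat.find_spec hexP
  have hmin : ∀ i < t, δ * ∑ x, D x ≤ ∑ x, D x * meas f pick σ i x := fun i hi =>
    not_lt.mp (Nat.find_min hexP hi)
  have hgood : ∀ i < t, hyp f pick σ i ∈ 𝒢 ∧ ε * ∑ x, D x * meas f pick σ i x ≤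
      ∑ x, D x * meas f pick σ i x * (if hyp f pick σ i x = f x then (1 : ℝ) else -1) := fun i hi =>
    hpick _ (fun x => (meas_mem f pick σ i x).1) (fun x => (meas_mem f pick σ i x).2) (hmin i hi)
  refine ⟨t, fun i => hyp f pick σ i, ?_, fun i => (hgood i i.2).1, ?_⟩
  · exact rounds_le D hD hW f pick hε hδ hσ t hmin fun i hi => (hgood i hi).2
  · -- on the bad set the `t`-th measure equals `1`
    have hbad : ∀ x ∈ univ.filter (fun x => ∑ i : Fin t,
        (if hyp f pick σ i x = f x then (1 : ℤ) else -1) ≤ 0), meas f pick σ t x = 1 := by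
      intro x hx
      rw [mem_filter] at hx
      have hm : margin f pick σ t x ≤ 0 := by
        rw [margin_eq_sum, ← Fin.sum_univ_eq_sum_range]
        exact hx.2
      exact clampW_of_nonpos (by rw [hσ]; positivity) (by exact_mod_cast hm)
    calc ∑ x ∈ univ.filter (fun x => ∑ i : Fin t,
            (if hyp f pick σ i x = f x then (1 : ℤ) else -1) ≤ 0), D x
        = ∑ x ∈ univ.filter (fun x => ∑ i : Fin t,
            (if hyp f pick σ i x = f x then (1 : ℤ) else -1) ≤ 0), D x * meas f pick σ t x := by
          refine sum_congr rfl fun x hx => ?_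
          rw [hbad x hx, mul_one]
      _ ≤ ∑ x, D x * meas f pick σ t x :=
          sum_le_sum_of_subset_of_nonneg (filter_subset _ _)
            fun x _ _ => mul_nonneg (hD x) (meas_mem f pick σ t x).1
      _ < δ * ∑ x, D x := ht

/-- **Impagliazzo's hard-core lemma, measure form.**  If `f` is `δ`-hard under the weight `D` for
every strict-majority vote of `t ≤ 4/(εδ)² + 2/(εδ)` predictors from `𝒢` (the vote is `≤ 0` on a
set of `D`-mass `≥ δ·D(X)`), then there is a HARD-CORE MEASURE `M : X → [0,1]` of `D`-mass
`≥ δ·D(X)` on which every `g ∈ 𝒢` has correlation advantage `< ε`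
(`Σ D·M·(±1)_{g=f} < ε Σ D·M`, i.e. `Pr_{D_M}[g = f] < 1/2 + ε/2`).
[cite: Impagliazzo1995, §4 Lemma 1; KlivansServedio2003, Thm 5] -/
theorem hardCore_measure (D : X → ℝ) (hD : ∀ x, 0 ≤ D x) (hW : 0 < ∑ x, D x) (f : X → Bool)
    (𝒢 : Set (X → Bool)) {ε δ : ℝ} (hε : 0 < ε) (hδ : 0 < δ)
    (hhard : ∀ (t : ℕ) (gs : Fin t → (X → Bool)), (t : ℝ) ≤ 4 / (ε * δ) ^ 2 + 2 / (ε * δ) →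
      (∀ i, gs i ∈ 𝒢) →
      δ * ∑ x, D x ≤
        ∑ x ∈ univ.filter (fun x => ∑ i, (if gs i x = f x then (1 : ℤ) else -1) ≤ 0), D x) :
    ∃ M : X → ℝ, (∀ x, 0 ≤ M x) ∧ (∀ x, M x ≤ 1) ∧ δ * ∑ x, D x ≤ ∑ x, D x * M x ∧
      ∀ g ∈ 𝒢, ∑ x, D x * M x * (if g x = f x then (1 : ℝ) else -1) < ε * ∑ x, D x * M x := by
  by_contra hno
  have hweak : ∀ M : X → ℝ, (∀ x, 0 ≤ M x) → (∀ x, M x ≤ 1) → δ * ∑ x, D x ≤ ∑ x, D x * M x →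
      ∃ g ∈ 𝒢, ε * ∑ x, D x * M x ≤ ∑ x, D x * M x * (if g x = f x then (1 : ℝ) else -1) := by
    intro M h0 h1 hd
    by_contra hg
    apply hno
    refine ⟨M, h0, h1, hd, fun g hg' => ?_⟩
    exact not_le.mp fun h => hg ⟨g, hg', h⟩
  obtain ⟨t, gs, ht, hgs, hlt⟩ := hardCore_boosting D hD hW f 𝒢 hε hδ hweak
  exact absurd (hhard t gs ht hgs) (not_le.mpr hlt)

end Boosting

end Summit.PneNP.PneNP.Theorems.NegLimitedDoor.HardCore
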